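import Summits.HodgeConjecture.HodgeConjecture.Theorems.F0P3cStCharTSUpTrTransferSide   -- ★ (P2) p852511 (F0P3a-p02): `sum_weylDiscrThree_mul_upSummand_mul_classOrbitalIntegral_eq`
import Mathlib.Topology.Algebra.ContinuousMonoidHom
import HarnessLib

/-!
# F0 · P3c · ROAD «UP-TR» brick (A1′)-F2 «hP2 OF (P2)»: the transfer-side fold of ★ (P2), re-indexed from a transversal `S ⊂ G` of the norm partners of `s` to the EMBEDDING FAMILY
# `i ↦ e_i s` of ★ (X2) — the `hP2` binder of ★ (A1′)-E `upTransferLB_concrete_of_inputs`, one `H`-Cartan at a time (Rogawski 1990 §4.3 (4.3.1), §4.9, §12.5 Lemma 12.5.1)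

Cell `pub/hodgecm-mathlib`, crux H413 = `stmt-HodgeConjecture-24833` (lane `--supports … --as helper`); seat LH10-p01 (g8); ROAD «UP-TR» (holder F0P3-p02 (g23)), brick (A1′) piece (F2).
THEOREMS ONLY; sorry-free; no definition ∕ instance ∕ notation ∕ named fact; ★-only imports; axioms TRIO.

WHAT.  ★ (P2) `sum_weylDiscrThree_mul_upSummand_mul_classOrbitalIntegral_eq` states, for a `G`-regular `s ∈ H_v` and a finite TRANSVERSAL `S` of its norm partners (pairwise non-conjugate,
exhaustive up to conjugacy): `Σ_{γ ∈ S} D_G(γ)·(τ(s) D_H(s) κ(s,γ) α(s))·Φ_G(⟦γ⟧, f) = D_H(s)²·α(s)·Φ^st_H(s, f^H)` under the `Δ‴`-transfer relation.  ★ (X2) `exists_psi_of_embFamily` delivers the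
partners of the points `s` of an `H`-Cartan `T` as a FAMILY `i ↦ ψ i s = e_i s` (`i : Fin k`) with `∃!`-uniqueness up to conjugacy.  **`sum_fin_weylDiscrThree_mul_upSummand_eq`** reads (P2) on
that family: `S := image (i ↦ e_i s)` is a transversal (injective in `i`, pairwise non-conjugate, exhaustive — all from the `∃!`), so `Σ_{i : Fin k} … (e_i s) … = D_H(s)²·α(s)·Φ^st_H(s, f^H)`
— the TYPE of ★ E's binder `hP2` at one `T`, with the closed forms `D_G = √√(∏|disc|·(∏|det|²)⁻¹)`, `D_H = √√(∏|disc|·(∏|det|)⁻¹)` inline.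
HONEST LABEL: count-neutral; UP-TR block consequents move only at the rider editions; organs 2 = 2; h413 registry untouched; HC_CM is proved only modulo the printed citations
until rung 0 closes.

## References
* [Rogawski1990] J. D. Rogawski, *Automorphic Representations of Unitary Groups in Three Variables*, Ann. of Math. Stud. 123 (1990), §4.3 (4.3.1) p. 43, §4.9 p. 55, §12.5 p. 183.
-/

set_option autoImplicit false
-- the mandated namespace has the single-problem summit's repeated segment (`HodgeConjecture.HodgeConjecture`)
set_option linter.dupNamespace false

noncomputable section

open MeasureTheory Measure Set Function NumberField IsDedekindDomain Matrix
open Literature.NumberTheory.Automorphic Literature.NumberTheory.Automorphic.UnitaryGroup Literature.NumberTheory.Rogawski1990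
open Literature.NumberTheory.GaloisRepresentations
open Summit.HodgeConjecture.HodgeConjecture.Cruxes.H413
open Summit.HodgeConjecture.HodgeConjecture.Cruxes.H413.F0P3cStCharTSUpTrTransferSide
open scoped NNReal MatrixGroups

namespace Summit.HodgeConjecture.HodgeConjecture.Cruxes.H413.F0P3cStCharTSUpTrAssemblyFold

section CM

variable (L : Type) [Field L] [NumberField L] [IsCMField L] (v : HeightOneSpectrum (𝓞 ↥(maximalRealSubfield L))) (μ : HeckeCharacter L)
  (hl : ∀ (v : HeightOneSpectrum (𝓞 ↥(maximalRealSubfield L)))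
    (a : ((UnitaryGroup.cmDatum L 2 (Matrix.of fun i j : Fin 2 => if i.val + j.val + 1 = 2 then (1 : L) else 0)).Local v × (UnitaryGroup.cmDatum L 1 (Matrix.of fun i j : Fin 1 => if i.val + j.val + 1 = 1 then (1 : L) else 0)).Local v)) (b : (UnitaryGroup.cmDatum L 3 (qsForm L)).Local v) (x : ((UnitaryGroup.cmDatum L 2 (Matrix.of fun i j : Fin 2 => if i.val + j.val + 1 = 2 then (1 : L) else 0)).Local v × (UnitaryGroup.cmDatum L 1 (Matrix.of fun i j : Fin 1 => if i.val + j.val + 1 = 1 then (1 : L) else 0)).Local v)),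
    finExplicitDelta L v (qsForm L) (x * a * x⁻¹) μ b = finExplicitDelta L v (qsForm L) a μ b)
  (hr : ∀ (v : HeightOneSpectrum (𝓞 ↥(maximalRealSubfield L)))
    (a : ((UnitaryGroup.cmDatum L 2 (Matrix.of fun i j : Fin 2 => if i.val + j.val + 1 = 2 then (1 : L) else 0)).Local v × (UnitaryGroup.cmDatum L 1 (Matrix.of fun i j : Fin 1 => if i.val + j.val + 1 = 1 then (1 : L) else 0)).Local v)) (b y : (UnitaryGroup.cmDatum L 3 (qsForm L)).Local v),
    finExplicitDelta L v (qsForm L) a μ (y * b * y⁻¹) = finExplicitDelta L v (qsForm L) a μ b)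
  [∀ γ : Gqs L v, MeasurableSpace (Gqs L v ⧸ Subgroup.centralizer ({γ} : Set (Gqs L v)))]
  (mQv : OrbitalMeasureFamily (Gqs L v)) (f : Gqs L v → ℂ)

/-- **(A1′)-F2 «hP2 OF (P2)» on the embedding family.**  `T ≤ H_v`, embeddings `e_i : T ≃ₜ* Z_G(γ_i)` (`i : Fin k`) with `ψ i = e_i` on `T`, every `ψ i s` a norm partner of the `G`-regular
`s ∈ T` (`hψR`) and EVERY partner conjugate to exactly one `ψ i s` (`hψuniq`); `f^H` a `Δ‴`-transfer of `f`.  Then at a `G`-regular `s ∈ T`: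
`Σ_{i : Fin k} D_G(e_i s) · (τ(s) D_H(s) κ(s, e_i s) α(s)) · Φ_G(⟦e_i s⟧, f) = D_H(s)² · α(s) · Φ^st_H(s, f^H)` — ★ (P2) at the transversal `S := {e_i s}`.
[cite: Rogawski1990, §4.3 (4.3.1) p. 43; §4.9 p. 55; §12.5 p. 183, Lemma 12.5.1] -/
theorem sum_fin_weylDiscrThree_mul_upSummand_eq (hns : ∀ w : PlacesOver L v, IsCMField.complexConj L • w.1 = w.1)
    [∀ a : ((UnitaryGroup.cmDatum L 2 (Matrix.of fun i j : Fin 2 => if i.val + j.val + 1 = 2 then (1 : L) else 0)).Local v × (UnitaryGroup.cmDatum L 1 (Matrix.of fun i j : Fin 1 => if i.val + j.val + 1 = 1 then (1 : L) else 0)).Local v), MeasurableSpace (((UnitaryGroup.cmDatum L 2 (Matrix.of fun i j : Fin 2 => if i.val + j.val + 1 = 2 then (1 : L) else 0)).Local v × (UnitaryGroup.cmDatum L 1 (Matrix.of fun i j : Fin 1 => if i.val + j.val + 1 = 1 then (1 : L) else 0)).Local v) ⧸ Subgroup.centralizer ({a} : Set ((UnitaryGroup.cmDatum L 2 (Matrix.of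 fun i j : Fin 2 => if i.val + j.val + 1 = 2 then (1 : L) else 0)).Local v × (UnitaryGroup.cmDatum L 1 (Matrix.of fun i j : Fin 1 => if i.val + j.val + 1 = 1 then (1 : L) else 0)).Local v)))]
    (mHv : OrbitalMeasureFamily ((UnitaryGroup.cmDatum L 2 (Matrix.of fun i j : Fin 2 => if i.val + j.val + 1 = 2 then (1 : L) else 0)).Local v × (UnitaryGroup.cmDatum L 1 (Matrix.of fun i j : Fin 1 => if i.val + j.val + 1 = 1 then (1 : L) else 0)).Local v)) (fH : ((UnitaryGroup.cmDatum L 2 (Matrix.of fun i j : Fin 2 => if i.val + j.val + 1 = 2 then (1 : L) else 0)).Local v × (UnitaryGroup.cmDatum L 1 (Matrix.of fun i j : Fin 1 => if i.val + j.val + 1 = 1 then (1 : L) else 0)).Local v) → ℂ)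
    (hT : IsLocalDeltaTransfer L (qsForm L) v (finExplicitCollection L (qsForm L) μ hl hr v) mHv mQv fH f)
    {T : Subgroup ((UnitaryGroup.cmDatum L 2 (Matrix.of fun i j : Fin 2 => if i.val + j.val + 1 = 2 then (1 : L) else 0)).Local v × (UnitaryGroup.cmDatum L 1 (Matrix.of fun i j : Fin 1 => if i.val + j.val + 1 = 1 then (1 : L) else 0)).Local v)} {k : ℕ} (γc : Fin k → Gqs L v)
    (eT : (i : Fin k) → (↥T ≃ₜ* ↥(Subgroup.centralizer ({γc i} : Set (Gqs L v)))))
    (ψ : Fin k → ((UnitaryGroup.cmDatum L 2 (Matrix.of fun i j : Fin 2 => if i.val + j.val + 1 = 2 then (1 : L) else 0)).Local v × (UnitaryGroup.cmDatum L 1 (Matrix.of fun i j : Fin 1 => if i.val + j.val + 1 = 1 then (1 : L) else 0)).Local v) → Gqs L v) (hψ : ∀ (i : Fin k) (x : ↥T), ψ i x = ((eT i x : ↥(Subgroup.centralizer ({γc i} : Set (Gqs L v)))) : Gqs L v))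
    (hψR : ∀ (i : Fin k), ∀ s ∈ T, IsLocalGRegular L v s → IsLocalNormPair L (qsForm L) v s (ψ i s))
    (hψuniq : ∀ s ∈ T, IsLocalGRegular L v s → ∀ g : Gqs L v, IsLocalNormPair L (qsForm L) v s g → ∃! i : Fin k, IsConj (ψ i s) g)
    (α : ((UnitaryGroup.cmDatum L 2 (Matrix.of fun i j : Fin 2 => if i.val + j.val + 1 = 2 then (1 : L) else 0)).Local v × (UnitaryGroup.cmDatum L 1 (Matrix.of fun i j : Fin 1 => if i.val + j.val + 1 = 1 then (1 : L) else 0)).Local v) → ℂ) (s : ↥T) (hs : IsLocalGRegular L v (s : ((UnitaryGroup.cmDatum L 2 (Matrix.of fun i j : Fin 2 => if i.val + j.val + 1 = 2 then (1 : L) else 0)).Local v × (UnitaryGroup.cmDatum L 1 (Matrix.of fun i j : Fin 1 => if i.val + j.val + 1 = 1 then (1 : L) else 0)).Local v))) :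
    ∑ i : Fin k, (((NNReal.sqrt (NNReal.sqrt ((∏ w : PlacesOver L v, IsNonarchimedeanLocalField.normAbs (w.1.adicCompletion L) ((((((eT i s : ↥(Subgroup.centralizer ({γc i} : Set (Gqs L v)))) : Gqs L v)).val : GL (Fin 3) (UnitaryGroup.LocalRing L v)).val.charpoly.discr) w)) * ((∏ w : PlacesOver L v, IsNonarchimedeanLocalField.normAbs (w.1.adicCompletion L) ((((((eT i s : ↥(Subgroup.centralizer ({γc i} : Set (Gqs L v)))) : Gqs L v)).val : GL (Fin 3) (UnitaryGroup.LocalRing L v)).val.det) w)) ^ 2)⁻¹)) : ℝ≥0) : ℝ) : ℂ) * (finTau L v s.1 μ * (((NNReal.sqrt (NNReal.sqrt ((∏ w : PlacesOver L v, IsNonarchimedeanLocalField.normAbs (w.1.adicCompletion L) (((s.1.1.val : GL (Fin 2) (UnitaryGroup.LocalRing L v)).val.charpoly.discr) w)) * (∏ w : PlacesOver L v, IsNonarchimedeanLocalField.normAbs (w.1.adicCompletion L) (((s.1.1.val : GL (Fin 2) (UnitaryGroup.LocalRing L v)).val.det) w))⁻¹)) : ℝ≥0) : ℝ) : ℂ)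 * ((finKappaAt L v (qsForm L) s.1 ((eT i s : ↥(Subgroup.centralizer ({γc i} : Set (Gqs L v)))) : Gqs L v) : ℤ) : ℂ) * α s.1) *
        classOrbitalIntegral mQv f (ConjClasses.mk ((eT i s : ↥(Subgroup.centralizer ({γc i} : Set (Gqs L v)))) : Gqs L v)) =
      (((NNReal.sqrt (NNReal.sqrt ((∏ w : PlacesOver L v, IsNonarchimedeanLocalField.normAbs (w.1.adicCompletion L) (((s.1.1.val : GL (Fin 2) (UnitaryGroup.LocalRing L v)).val.charpoly.discr) w)) * (∏ w : PlacesOver L v, IsNonarchimedeanLocalField.normAbs (w.1.adicCompletion L) (((s.1.1.val : GL (Fin 2) (UnitaryGroup.LocalRing L v)).val.det) w))⁻¹)) : ℝ≥0) : ℝ) : ℂ) ^ 2 * α s.1 * stableOrbitalIntegralRel (IsLocalStablyConjH L v) mHv fH s.1 := by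
  classical
  -- every `e_i s` is a norm partner of `s`
  have hpart : ∀ i : Fin k, IsLocalNormPair L (qsForm L) v s.1 ((eT i s : ↥(Subgroup.centralizer ({γc i} : Set (Gqs L v)))) : Gqs L v) := fun i => by
    rw [← hψ i s]; exact hψR i s.1 s.2 hs
  -- `i ↦ e_i s` is injective (the `∃!`)
  have hinjψ : Function.Injective fun i : Fin k => ((eT i s : ↥(Subgroup.centralizer ({γc i} : Set (Gqs L v)))) : Gqs L v) := by
    intro i j hij
    obtain ⟨i₀, -, huniq⟩ := hψuniq s.1 s.2 hs _ (hpart i)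
    have hi : i = i₀ := huniq i (by show IsConj (ψ i s.1) ((eT i s : ↥(Subgroup.centralizer ({γc i} : Set (Gqs L v)))) : Gqs L v); rw [hψ i s])
    have hj : j = i₀ := huniq j (by
      show IsConj (ψ j s.1) ((eT i s : ↥(Subgroup.centralizer ({γc i} : Set (Gqs L v)))) : Gqs L v)
      rw [hψ j s]; exact isConj_iff.2 ⟨1, by simpa using hij.symm⟩)
    rw [hi, hj]
  -- the transversal `S := {e_i s | i}`
  set S : Finset (Gqs L v) := Finset.univ.image fun i : Fin k => ((eT i s : ↥(Subgroup.centralizer ({γc i} : Set (Gqs L v)))) : Gqs L v) with hSdef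
  have hS : ∀ γ ∈ S, IsLocalNormPair L (qsForm L) v s.1 γ := by
    intro γ hγ
    obtain ⟨i, -, rfl⟩ := Finset.mem_image.1 hγ
    exact hpart i
  have hexh : ∀ γ : Gqs L v, IsLocalNormPair L (qsForm L) v s.1 γ → ∃ γc ∈ S, IsConj γc γ := by
    intro γ hγ
    obtain ⟨i, hi, -⟩ := hψuniq s.1 s.2 hs γ hγ
    refine ⟨((eT i s : ↥(Subgroup.centralizer ({γc i} : Set (Gqs L v)))) : Gqs L v), Finset.mem_image.2 ⟨i, Finset.mem_univ _, rfl⟩, ?_⟩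
    rw [← hψ i s]; exact hi
  have hinj : ∀ γ ∈ S, ∀ γ' ∈ S, γ ≠ γ' → ¬ IsConj γ γ' := by
    intro γ hγ γ' hγ' hne hc
    obtain ⟨i, -, rfl⟩ := Finset.mem_image.1 hγ
    obtain ⟨j, -, rfl⟩ := Finset.mem_image.1 hγ'
    obtain ⟨i₀, -, huniq⟩ := hψuniq s.1 s.2 hs _ (hpart j)
    have hi : i = i₀ := huniq i (by show IsConj (ψ i s.1) ((eT j s : ↥(Subgroup.centralizer ({γc j} : Set (Gqs L v)))) : Gqs L v); rw [hψ i s]; exact hc)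
    have hj : j = i₀ := huniq j (by show IsConj (ψ j s.1) ((eT j s : ↥(Subgroup.centralizer ({γc j} : Set (Gqs L v)))) : Gqs L v); rw [hψ j s])
    exact hne (by rw [hi, hj])
  -- ★ (P2) at `S`, then re-index `Σ_{γ ∈ S}` as `Σ_i`
  have key := sum_weylDiscrThree_mul_upSummand_mul_classOrbitalIntegral_eq L v μ hl hr mQv f hns mHv fH hT hs S hS hexh hinj α
  rw [hSdef, Finset.sum_image fun i _ j _ h => hinjψ h] at key
  exact key

end CM

end Summit.HodgeConjecture.HodgeConjecture.Cruxes.H413.F0P3cStCharTSUpTrAssemblyFold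

end
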